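import Summits.CriticalPhenomena.Ising3DConformalLimit.Theorems.LeeYangGapNearCriticalLeeYangGapCubeEdgeImpliesEdge
import Summits.CriticalPhenomena.Ising3DConformalLimit.Theorems.LeeYangGapNearCriticalLeeYangGapEdgeAnalyticity

/-!
# Near-critical Lee–Yang gap — the route's EDGE and its reverse, read on cube zeros

Route `LeeYangGap` (Ising3DConformalLimit), crux `NearCriticalLeeYangGap` (GAP, item
stmt-CriticalPhenomena-4945), line `registered`, lead c6; third companion of p165482 / p166341.

With `w(β) := inf_n α₁(Λ_n,β)` (the infimum over free cubes of the first Lee–Yang zero, Jiang–Newman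
normalisation) the two thermodynamic statements the line trades in become inequalities about classical
partition-function zeros of cubes, with NO analytic-function language:

* `edge_iff_infCubeZero` — **EDGE ⟺ `w(β)²·χ(β)·ξ(β)³ ≤ C` on a left neighbourhood of `β_c`**
  (route item stmt-CriticalPhenomena-4946 `YangLeeEdgeHyperscaling`, by name).
  ⟹: the landed S1e `stub_edgeAnalyticity` puts an analyticity strip of half-width `c·w(β)` under `m(β,·)`
  when `w(β) > 0`; ⟸: the unconditional `mul_le_firstZero_of_magnetization_strip` (p166341:
  `βθ ≤ α₁(Λ_n,β)` for every analyticity strip `θ` and every `n`).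
* `cubeReverseEdge_iff_reverseEdge` — **(I) ⟺ reverse EDGE**: reverse edge hyperscaling on every cube,
  `c ≤ α₁(Λ_n,β)²χξ³ ∀n`, is equivalent to the existence, for every `β` near `β_c`, of an analyticity strip
  of `m(β,·)` of half-width `θ` with `c' ≤ θ²χξ³` — lead c5's reading "S1r ⟹ θ_e²χξ³ ≥ c" made literal
  in the route's vocabulary (S1r ⟹ (I) is c5's `stub_reverseEdgeOfFirstZeroRate`, p162060).
* `stub_edgeIffInfCubeZeroScaling` — the registered (anatomy) form of the first item.

No new definitions, no named facts, no `sorry`; serves item stmt-CriticalPhenomena-4945 (`--supports`).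

## References

* J. Jiang, C. M. Newman, CPAM 77 (2024) 1224–1234 [JiangNewman2023]; C. M. Newman, CMP 41 (1975)
  [Newman1975]; S. Friedli, Y. Velenik, CUP 2017, §3.7 [FriedliVelenik2017].
-/

noncomputable section

namespace Summit.CriticalPhenomena.Ising3DConformalLimit.LeeYangGapNearCriticalLeeYangGap

open Filter Finset Topology
open Literature.Probability.LatticeModels
open Summit.CriticalPhenomena.Ising3DConformalLimit.Theses.LeeYangGap (YangLeeEdgeHyperscaling)

/-! ### The infimum of the cube first zeros -/

/-- The cube first zeros are bounded below (by `0`). -/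
theorem bddBelow_range_firstZero (β : ℝ) :
    BddBelow (Set.range fun n : ℕ => JiangNewman.firstZero 3 (box 3 n) β) :=
  ⟨0, by rintro _ ⟨n, rfl⟩; exact JiangNewman.firstZero_nonneg 3 (box 3 n) β⟩

/-- `w(β) = inf_n α₁(Λ_n,β) ≤ α₁(Λ_n,β)`. -/
theorem infCubeZero_le (β : ℝ) (n : ℕ) :
    (⨅ m : ℕ, JiangNewman.firstZero 3 (box 3 m) β) ≤ JiangNewman.firstZero 3 (box 3 n) β :=
  ciInf_le (bddBelow_range_firstZero β) n

/-- `0 ≤ w(β)`. -/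
theorem infCubeZero_nonneg (β : ℝ) : 0 ≤ ⨅ m : ℕ, JiangNewman.firstZero 3 (box 3 m) β :=
  le_ciInf fun m => JiangNewman.firstZero_nonneg 3 (box 3 m) β

/-- **Every analyticity strip of `m(β,·)` lies below `w(β)/β`** (`0 < β < β_c`; p166341's
`mul_le_firstZero_of_magnetization_strip` under the infimum). -/
theorem mul_le_infCubeZero_of_magnetization_strip {β : ℝ} (hβ : 0 < β) (hβc : β < criticalBeta 3)
    {θ : ℝ} (hθ : 0 < θ) {F : ℂ → ℂ} (hF : DifferentiableOn ℂ F {z : ℂ | |z.im| < θ})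
    (hFm : ∀ h : ℝ, 0 ≤ h → F (h : ℂ) = ((magnetizationInField 3 β h : ℝ) : ℂ)) :
    β * θ ≤ ⨅ m : ℕ, JiangNewman.firstZero 3 (box 3 m) β :=
  le_ciInf fun m => mul_le_firstZero_of_magnetization_strip (d := 3) (by norm_num) hβ hβc hθ hF hFm m

/-! ### EDGE ⟺ edge hyperscaling for `w(β)` -/

/-- **EDGE read on cube zeros**: the route item `YangLeeEdgeHyperscaling` (stmt-CriticalPhenomena-4946)
holds iff `w(β)²·χ(β)·ξ(β)³` is bounded on a left neighbourhood of `β_c`, `w(β) = inf_n α₁(Λ_n,β)`. -/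
theorem edge_iff_infCubeZero :
    YangLeeEdgeHyperscaling ↔
    (∃ C β₀ : ℝ, β₀ < criticalBeta 3 ∧ ∀ β : ℝ, β₀ ≤ β → β < criticalBeta 3 →
      (⨅ m : ℕ, JiangNewman.firstZero 3 (box 3 m) β) ^ 2 * (susceptibility 3 β).toReal *
        isingCorrLength 3 β ^ 3 ≤ C) := by
  have hβc : 0 < criticalBeta 3 := criticalBeta_pos_holds (d := 3) (by norm_num)
  constructor
  · rintro ⟨C, β₀, hβ₀, hE⟩
    obtain ⟨c, β₀'', hc, hβ₀'', hAn⟩ := stub_edgeAnalyticity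
    refine ⟨max (C / c ^ 2) 0, max (max β₀ β₀'') (criticalBeta 3 / 2),
      max_lt (max_lt hβ₀ hβ₀'') (by linarith), fun β hβ hββc => ?_⟩
    have hβ₀β : β₀ ≤ β := le_trans (le_max_left _ _) (le_trans (le_max_left _ _) hβ)
    have hβ₀''β : β₀'' ≤ β := le_trans (le_max_right _ _) (le_trans (le_max_left _ _) hβ)
    have hβpos : 0 < β := lt_of_lt_of_le (by linarith) (le_trans (le_max_right _ _) hβ)
    set w := ⨅ m : ℕ, JiangNewman.firstZero 3 (box 3 m) β with hw
    have hw0 : 0 ≤ w := infCubeZero_nonneg β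
    have hP0 : 0 ≤ (susceptibility 3 β).toReal * isingCorrLength 3 β ^ 3 :=
      mul_nonneg ENNReal.toReal_nonneg (pow_nonneg (isingCorrLength_pos hβpos hββc).le 3)
    rcases hw0.eq_or_lt with hw00 | hwpos
    · -- `w = 0`: the left side vanishes
      rw [← hw00]
      simp only [ne_eq, OfNat.ofNat_ne_zero, not_false_eq_true, zero_pow, zero_mul]
      exact le_max_right _ _
    · -- `w > 0`: S1e gives the strip `c·w`, EDGE bounds it
      obtain ⟨F, hF, hFm⟩ := hAn β hβ₀''β hββc w hwpos (fun n => infCubeZero_le β n)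
      have hEw := hE β (c * w) hβ₀β hββc (by positivity) ⟨F, hF, hFm⟩
      refine le_trans ?_ (le_max_left _ _)
      rw [le_div_iff₀ (pow_pos hc 2)]
      calc w ^ 2 * (susceptibility 3 β).toReal * isingCorrLength 3 β ^ 3 * c ^ 2
          = (c * w) ^ 2 * (susceptibility 3 β).toReal * isingCorrLength 3 β ^ 3 := by ring
        _ ≤ C := hEw
  · rintro ⟨C, β₀, hβ₀, hII⟩
    refine ⟨4 * C / criticalBeta 3 ^ 2 ⊔ 0, max β₀ (criticalBeta 3 / 2), max_lt hβ₀ (by linarith),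
      fun β θ hβ hββc hθ hF => ?_⟩
    obtain ⟨F, hF, hFm⟩ := hF
    have hβ₀β : β₀ ≤ β := (le_max_left _ _).trans hβ
    have hβhalf : criticalBeta 3 / 2 ≤ β := (le_max_right _ _).trans hβ
    have hβpos : 0 < β := lt_of_lt_of_le (by linarith) hβhalf
    set w := ⨅ m : ℕ, JiangNewman.firstZero 3 (box 3 m) β with hw
    have hedge : β * θ ≤ w := mul_le_infCubeZero_of_magnetization_strip hβpos hββc hθ hF hFm
    have hP0 : 0 ≤ (susceptibility 3 β).toReal * isingCorrLength 3 β ^ 3 :=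
      mul_nonneg ENNReal.toReal_nonneg (pow_nonneg (isingCorrLength_pos hβpos hββc).le 3)
    have hcube := hII β hβ₀β hββc
    have hC0 : 0 ≤ C := by
      refine le_trans ?_ hcube
      rw [mul_assoc]
      exact mul_nonneg (sq_nonneg _) hP0
    have h1 : (β * θ) ^ 2 * ((susceptibility 3 β).toReal * isingCorrLength 3 β ^ 3) ≤ C := by
      calc (β * θ) ^ 2 * ((susceptibility 3 β).toReal * isingCorrLength 3 β ^ 3)
          ≤ w ^ 2 * ((susceptibility 3 β).toReal * isingCorrLength 3 β ^ 3) :=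
            mul_le_mul_of_nonneg_right (pow_le_pow_left₀ (by positivity) hedge 2) hP0
        _ ≤ C := by rw [← mul_assoc]; exact hcube
    refine le_trans ?_ (le_max_left _ _)
    rw [le_div_iff₀ (pow_pos hβc 2)]
    have h3 : criticalBeta 3 ^ 2 ≤ 4 * β ^ 2 := by nlinarith
    have h4 : 0 ≤ θ ^ 2 * (susceptibility 3 β).toReal * isingCorrLength 3 β ^ 3 := by
      have := mul_nonneg (sq_nonneg θ) hP0
      simpa [mul_assoc] using this
    calc θ ^ 2 * (susceptibility 3 β).toReal * isingCorrLength 3 β ^ 3 * criticalBeta 3 ^ 2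
        ≤ θ ^ 2 * (susceptibility 3 β).toReal * isingCorrLength 3 β ^ 3 * (4 * β ^ 2) :=
          mul_le_mul_of_nonneg_left h3 h4
      _ = 4 * ((β * θ) ^ 2 * ((susceptibility 3 β).toReal * isingCorrLength 3 β ^ 3)) := by ring
      _ ≤ 4 * C := by linarith

/-! ### (I) ⟺ reverse EDGE -/

/-- **Reverse edge hyperscaling on cubes ⟺ reverse EDGE in the route's vocabulary**: (I)
`∃ c>0, β₁<β_c, ∀β∈[β₁,β_c) ∀n, c ≤ α₁(Λ_n,β)²χξ³` holds iff for every `β` near `β_c` the magnetisation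
`m(β,·)` has SOME analyticity strip `{|Im h| < θ}` with `c' ≤ θ²χξ³`
(⟹: `w(β) ≥ √(c/(χξ³)) > 0` and S1e's strip `c₀·w(β)`; ⟸: `βθ ≤ α₁(Λ_n,β)` for every `n`, p166341). -/
theorem cubeReverseEdge_iff_reverseEdge :
    (∃ c β₁ : ℝ, 0 < c ∧ β₁ < criticalBeta 3 ∧ ∀ β : ℝ, β₁ ≤ β → β < criticalBeta 3 → ∀ n : ℕ,
        c ≤ JiangNewman.firstZero 3 (box 3 n) β ^ 2 * (susceptibility 3 β).toReal *
          isingCorrLength 3 β ^ 3) ↔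
    (∃ c β₁ : ℝ, 0 < c ∧ β₁ < criticalBeta 3 ∧ ∀ β : ℝ, β₁ ≤ β → β < criticalBeta 3 →
      ∃ θ : ℝ, 0 < θ ∧
        (∃ F : ℂ → ℂ, DifferentiableOn ℂ F {z : ℂ | |z.im| < θ} ∧
          ∀ h : ℝ, 0 ≤ h → F (h : ℂ) = ((magnetizationInField 3 β h : ℝ) : ℂ)) ∧
        c ≤ θ ^ 2 * (susceptibility 3 β).toReal * isingCorrLength 3 β ^ 3) := by
  have hβc : 0 < criticalBeta 3 := criticalBeta_pos_holds (d := 3) (by norm_num)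
  constructor
  · rintro ⟨c, β₁, hc, hβ₁, hI⟩
    obtain ⟨c₀, β₀'', hc₀, hβ₀'', hAn⟩ := stub_edgeAnalyticity
    refine ⟨c₀ ^ 2 * c, max β₁ β₀'', by positivity, max_lt hβ₁ hβ₀'', fun β hβ hββc => ?_⟩
    have hβ₁β : β₁ ≤ β := (le_max_left _ _).trans hβ
    have hβ₀''β : β₀'' ≤ β := (le_max_right _ _).trans hβ
    set P := (susceptibility 3 β).toReal * isingCorrLength 3 β ^ 3 with hP
    have hlow : ∀ n : ℕ, c ≤ JiangNewman.firstZero 3 (box 3 n) β ^ 2 * P := fun n => by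
      have := hI β hβ₁β hββc n; rw [hP, ← mul_assoc]; exact this
    -- positivity of `P = χξ³`, read off (I)
    have hP0 : 0 < P := by
      have hprod : 0 < JiangNewman.firstZero 3 (box 3 0) β ^ 2 * P := hc.trans_le (hlow 0)
      rcases lt_or_ge 0 P with h | h
      · exact h
      · exact absurd hprod (not_lt.2 (mul_nonpos_of_nonneg_of_nonpos (sq_nonneg _) h))
    -- `w := √(c/P) ≤ α₁(Λ_n)` for every `n`
    set w : ℝ := Real.sqrt (c / P) with hw
    have hwpos : 0 < w := Real.sqrt_pos.2 (div_pos hc hP0)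
    have hwle : ∀ n : ℕ, w ≤ JiangNewman.firstZero 3 (box 3 n) β := by
      intro n
      have hα0 : 0 ≤ JiangNewman.firstZero 3 (box 3 n) β := JiangNewman.firstZero_nonneg 3 _ β
      have h1 : c / P ≤ JiangNewman.firstZero 3 (box 3 n) β ^ 2 := by
        rw [div_le_iff₀ hP0]; exact hlow n
      calc w = Real.sqrt (c / P) := hw
        _ ≤ Real.sqrt (JiangNewman.firstZero 3 (box 3 n) β ^ 2) := Real.sqrt_le_sqrt h1
        _ = JiangNewman.firstZero 3 (box 3 n) β := Real.sqrt_sq hα0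
    obtain ⟨F, hF, hFm⟩ := hAn β hβ₀''β hββc w hwpos hwle
    refine ⟨c₀ * w, by positivity, ⟨F, hF, hFm⟩, ?_⟩
    have hw2 : w ^ 2 = c / P := by rw [hw, Real.sq_sqrt (div_pos hc hP0).le]
    have : (c₀ * w) ^ 2 * P = c₀ ^ 2 * c := by
      rw [mul_pow, hw2]; field_simp
    have heq : c₀ ^ 2 * c = (c₀ * w) ^ 2 * (susceptibility 3 β).toReal * isingCorrLength 3 β ^ 3 := by
      rw [← this, hP, ← mul_assoc]
    exact heq.le
  · rintro ⟨c, β₁, hc, hβ₁, hR⟩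
    refine ⟨(criticalBeta 3 / 2) ^ 2 * c, max β₁ (criticalBeta 3 / 2), by positivity,
      max_lt hβ₁ (by linarith), fun β hβ hββc n => ?_⟩
    have hβ₁β : β₁ ≤ β := (le_max_left _ _).trans hβ
    have hβhalf : criticalBeta 3 / 2 ≤ β := (le_max_right _ _).trans hβ
    have hβpos : 0 < β := lt_of_lt_of_le (by linarith) hβhalf
    obtain ⟨θ, hθ, ⟨F, hF, hFm⟩, hcθ⟩ := hR β hβ₁β hββc
    have hedge : β * θ ≤ JiangNewman.firstZero 3 (box 3 n) β :=
      mul_le_firstZero_of_magnetization_strip (d := 3) (by norm_num) hβpos hββc hθ hF hFm n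
    have hP0 : 0 ≤ (susceptibility 3 β).toReal * isingCorrLength 3 β ^ 3 :=
      mul_nonneg ENNReal.toReal_nonneg (pow_nonneg (isingCorrLength_pos hβpos hββc).le 3)
    have h1 : θ ^ 2 * ((susceptibility 3 β).toReal * isingCorrLength 3 β ^ 3) ≥ c := by
      rw [← mul_assoc]; exact hcθ
    have h2 : (β * θ) ^ 2 * ((susceptibility 3 β).toReal * isingCorrLength 3 β ^ 3) ≤
        JiangNewman.firstZero 3 (box 3 n) β ^ 2 *
          ((susceptibility 3 β).toReal * isingCorrLength 3 β ^ 3) :=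
      mul_le_mul_of_nonneg_right (pow_le_pow_left₀ (by positivity) hedge 2) hP0
    have h3 : (criticalBeta 3 / 2) ^ 2 ≤ β ^ 2 := pow_le_pow_left₀ (by positivity) hβhalf 2
    have h4 : 0 ≤ θ ^ 2 * ((susceptibility 3 β).toReal * isingCorrLength 3 β ^ 3) :=
      mul_nonneg (sq_nonneg _) hP0
    calc (criticalBeta 3 / 2) ^ 2 * c
        ≤ β ^ 2 * (θ ^ 2 * ((susceptibility 3 β).toReal * isingCorrLength 3 β ^ 3)) :=
          mul_le_mul h3 h1 hc.le (sq_nonneg _)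
      _ = (β * θ) ^ 2 * ((susceptibility 3 β).toReal * isingCorrLength 3 β ^ 3) := by ring
      _ ≤ JiangNewman.firstZero 3 (box 3 n) β ^ 2 *
          ((susceptibility 3 β).toReal * isingCorrLength 3 β ^ 3) := h2
      _ = JiangNewman.firstZero 3 (box 3 n) β ^ 2 * (susceptibility 3 β).toReal *
          isingCorrLength 3 β ^ 3 := by rw [← mul_assoc]

/-! ### Registered form -/

/-- **`stub_edgeIffInfCubeZeroScaling` — EDGE ⟺ edge hyperscaling for `w(β) = inf_n α₁(Λ_n,β)`**
(registered anatomy stub of line `registered`, verbatim; it is `edge_iff_infCubeZero`). -/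
theorem stub_edgeIffInfCubeZeroScaling :
    Summit.CriticalPhenomena.Ising3DConformalLimit.Theses.LeeYangGap.YangLeeEdgeHyperscaling ↔ (∃ C β₀ : ℝ, β₀ < Literature.Probability.LatticeModels.criticalBeta 3 ∧ ∀ β : ℝ, β₀ ≤ β → β < Literature.Probability.LatticeModels.criticalBeta 3 → (⨅ m : ℕ, Literature.Probability.LatticeModels.JiangNewman.firstZero 3 (Literature.Probability.LatticeModels.box 3 m) β) ^ 2 * (Literature.Probability.LatticeModels.susceptibility 3 β).toReal * Literature.Probability.LatticeModels.isingCorrLength 3 β ^ 3 ≤ C) :=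
  edge_iff_infCubeZero

end Summit.CriticalPhenomena.Ising3DConformalLimit.LeeYangGapNearCriticalLeeYangGap

end
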